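import Summits.BirchSwinnertonDyer.BirchSwinnertonDyer.Theorems.KatoDescentPotSupersingularCartanMuRoadFukudaDoorsWild
import Literature.NumberTheory.IwasawaTheory.Fukuda1994Thm1RankProofs
import HarnessLib

/-!
# The Cartan μ-road Fukuda RANK doors at `p = 3` with Fukuda's Theorem 1 (2) DISCHARGED

Written by the prover seat `bsd-potss-k8t-c4` g20 (cell `bsd-potss`; supports stmt-BirchSwinnertonDyer-19982 (KT) and
stmt-BirchSwinnertonDyer-19197 (K9); closes nothing). The six `…_of_realRankSuccEqAt` doors of
`Theorems.CartanMuRoadFukudaDoorsTprime` (K8-t′, `SubTprime` rows) and `Theorems.CartanMuRoadFukudaDoorsWild` (K9, `ClassO6` rows)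
took Fukuda's Theorem 1 (2) (p-RANKS, with its rider `μ = 0`) as the named-fact hypothesis
`hF2 : fukuda1994_thm1_classGroupPRank_const_of_succ_eq`; that fact is now PROVED in the tree
(`Literature/NumberTheory/IwasawaTheory/Fukuda1994Thm1RankProofs.lean`, `fukuda1994_thm1_classGroupPRank_const_of_succ_eq_holds`, at
finite level and without Iwasawa's structure theory), so this file re-issues the six doors WITHOUT `hF2` (same names, namespace
`CartanMuRoadFukudaDoorsF2`). Every per-row record `conjA_g<label>_3_fukuda` / `missingUpperBoundAt_g<label>_3_fukuda` /
`classO6_g<label>_3_fukuda` of the RANK-STABLE rows (KT: 198927v1, 486720db1, 486720dc1; K9: the `hrk` rows of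
`WildUpperMuRoadThreeFukudaRecords`) loses its `hF2` hypothesis by the same one-line application. The remaining named-fact hypotheses
(`hCS` Coates–Sujatha Thm. 3.4, `hI` Iwasawa 1959 where displayed, `hFW` Ferrero–Washington, and for the upper-bound doors `hKatoA`, `hGZK`,
`hmod`) are untouched. BSD is not advanced by this bookkeeping; it removes one conditional input from the K8-t′/K9 Fukuda rank records.
-/

set_option linter.dupNamespace false
set_option autoImplicit false

noncomputable section

open scoped Classical NumberField
open Field IntermediateField WeierstrassCurve IsDedekindDomain Polynomial
  Literature.NumberTheory.EllipticCurves Literature.NumberTheory.EllipticCurves.Rank1Residual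
  Literature.NumberTheory.EllipticCurves.Rank1Residual.Typed
  Literature.NumberTheory.GaloisRepresentations Literature.NumberTheory.SerreUniformity
  Literature.NumberTheory.IwasawaTheory
  Summit.BirchSwinnertonDyer.Rank1Residual Summit.BirchSwinnertonDyer.Rank1Residual.Additive
  Summit.BirchSwinnertonDyer.BirchSwinnertonDyer.Theorems.PrintX8TotallyRamified
  Summit.BirchSwinnertonDyer.BirchSwinnertonDyer.Theorems.AdditiveBranchIMCGordTwoRankOne

namespace Summit.BirchSwinnertonDyer.BirchSwinnertonDyer.Theorems.CartanMuRoadFukudaDoorsF2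

/-- **(A) at `(W,3)` on a `3Ns` row from Fukuda Thm. 1 (2) (`3`-RANKS) at layers `(n, n+1)` of the tower of `ℚ(P)`, `hram`-FREE**
(modulo `hCS`, `hFW`, `hF2`): `rank₃ Cl(ℚ(P)_{n+1}) = rank₃ Cl(ℚ(P)_n)` (`hrk`). CONDITIONAL. [cite: Fukuda1994, Thm. 1 (2), p. 264]
[cite: CoatesSujatha2005, Thm. 3.4 (§3)] [cite: Serre1972, §2.4 Prop. 15, §5.2 (iv)]
UNCONDITIONAL IN FUKUDA: the hypothesis `hF2 : fukuda1994_thm1_classGroupPRank_const_of_succ_eq` of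
`CartanMuRoadFukudaDoorsTprime.conjA_three_of_hasSplitCartanNormalizerModPImage_of_realRankSuccEqAt` is discharged by `fukuda1994_thm1_classGroupPRank_const_of_succ_eq_holds`. -/
theorem conjA_three_of_hasSplitCartanNormalizerModPImage_of_realRankSuccEqAt
    (W : WeierstrassCurve ℚ) [W.IsElliptic]
    (hCS : CoatesSujatha2005.thm34_fineSelmerDual_moduleFinite_of_classicalMuVanishes_divisionField)
    (hFW : ferreroWashington1979_classicalMuVanishes)
    (hirr : W.HasIrreducibleModPGaloisRep 3) (himg : HasSplitCartanNormalizerModPImage W 3)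
    {c : absoluteGaloisGroup ℚ} (hc : IsComplexConjugation (Rat.castHom ℝ) c) (n : ℕ)
    (hrk : ∀ κE : ZpExtension ↥(fixedField (Subgroup.zpowers (absRestrictNormalHom (W.divisionField 3) c))) 3,
      κE.IsCyclotomic → classGroupPRank κE (n + 1) = classGroupPRank κE n)
    (κ : ZpExtension ℚ 3) (hκ : κ.IsCyclotomic) :
    ∃ (γ : absoluteGaloisGroup ℚ) (D : W.FineSelmerDualData κ γ),
      Module.Finite ℤ_[3] (RestrictScalars ℤ_[3] (IwasawaAlgebra 3) D.X) := by
  apply CartanMuRoadFukudaDoorsTprime.conjA_three_of_hasSplitCartanNormalizerModPImage_of_realRankSuccEqAt <;>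
    first
    | exact Literature.NumberTheory.IwasawaTheory.fukuda1994_thm1_classGroupPRank_const_of_succ_eq_holds
    | assumption

/-- **(A) at `(W,3)` on a `3Nn` row from Fukuda Thm. 1 (2) (`3`-RANKS) at layers `(n, n+1)` of the tower of `ℚ(P)`, `hram`-FREE, paying
`hI`** (modulo `hCS`, `hI`, `hFW`, `hF2`): `rank₃ Cl(ℚ(P)_{n+1}) = rank₃ Cl(ℚ(P)_n)` (`hrk`). The door for the KT rows 198927v1,
486720db1, 486720dc1 (RANK-STABLE at `(0,1)`). CONDITIONAL. [cite: Fukuda1994, Thm. 1 (2), p. 264] [cite: CoatesSujatha2005, Thm. 3.4 (§3)]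
[cite: Serre1972, §2.4 Prop. 15, §5.2 (iv)]
UNCONDITIONAL IN FUKUDA: the hypothesis `hF2 : fukuda1994_thm1_classGroupPRank_const_of_succ_eq` of
`CartanMuRoadFukudaDoorsTprime.conjA_three_of_hasModPImageEqNonsplitCartanNormalizer_of_realRankSuccEqAt'` is discharged by `fukuda1994_thm1_classGroupPRank_const_of_succ_eq_holds`. -/
theorem conjA_three_of_hasModPImageEqNonsplitCartanNormalizer_of_realRankSuccEqAt'
    (W : WeierstrassCurve ℚ) [W.IsElliptic]
    (hCS : CoatesSujatha2005.thm34_fineSelmerDual_moduleFinite_of_classicalMuVanishes_divisionField)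
    (hI : iwasawa1959_classNumberPExp_growth) (hFW : ferreroWashington1979_classicalMuVanishes)
    (hirr : W.HasIrreducibleModPGaloisRep 3) (himg : HasModPImageEqNonsplitCartanNormalizer W 3)
    {c : absoluteGaloisGroup ℚ} (hc : IsComplexConjugation (Rat.castHom ℝ) c) (n : ℕ)
    (hrk : ∀ κE : ZpExtension ↥(fixedField (Subgroup.zpowers (absRestrictNormalHom (W.divisionField 3) c))) 3,
      κE.IsCyclotomic → classGroupPRank κE (n + 1) = classGroupPRank κE n)
    (κ : ZpExtension ℚ 3) (hκ : κ.IsCyclotomic) :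
    ∃ (γ : absoluteGaloisGroup ℚ) (D : W.FineSelmerDualData κ γ),
      Module.Finite ℤ_[3] (RestrictScalars ℤ_[3] (IwasawaAlgebra 3) D.X) := by
  apply CartanMuRoadFukudaDoorsTprime.conjA_three_of_hasModPImageEqNonsplitCartanNormalizer_of_realRankSuccEqAt' <;>
    first
    | exact Literature.NumberTheory.IwasawaTheory.fukuda1994_thm1_classGroupPRank_const_of_succ_eq_holds
    | assumption

/-- **U₀ at a `3Ns` (t′) row from Fukuda Thm. 1 (2) (`3`-ranks) on `ℚ(P)`, `hram`-FREE** (named facts `hKatoA hGZK hmod hCS hFW hF2`;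
`rank₃ Cl(ℚ(P)_{n+1}) = rank₃ Cl(ℚ(P)_n)`). CONDITIONAL; nothing booked; BSD for no curve.
[cite: Kato2004Asterisque, Thm. 14.5 (3) (p. 236)] [cite: Fukuda1994, Thm. 1 (2), p. 264] [cite: CoatesSujatha2005, Thm. 3.4 (§3)]
[cite: Serre1972, §2.4 Prop. 15, §5.2 (iv)]
UNCONDITIONAL IN FUKUDA: the hypothesis `hF2 : fukuda1994_thm1_classGroupPRank_const_of_succ_eq` of
`CartanMuRoadFukudaDoorsTprime.missingUpperBoundAt_three_tame_of_hasSplitCartanNormalizerModPImage_of_realRankSuccEqAt` is discharged by `fukuda1994_thm1_classGroupPRank_const_of_succ_eq_holds`. -/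
theorem missingUpperBoundAt_three_tame_of_hasSplitCartanNormalizerModPImage_of_realRankSuccEqAt
    (W : WeierstrassCurve ℚ) [W.IsElliptic] [W.IsGloballyMinimal]
    (hKatoA : Kato2004.rankZero_padicValNat_sha_add_padicValNat_tamagawa_le_of_additive_potGood_of_irreducible_of_fineSelmerDual_fg)
    (hGZK : rank_eq_analyticRank_of_analyticRank_le_one) (hmod : hasEntireLFunction_rat)
    (hCS : CoatesSujatha2005.thm34_fineSelmerDual_moduleFinite_of_classicalMuVanishes_divisionField)
    (hFW : ferreroWashington1979_classicalMuVanishes)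
    [Fact (3 : ℕ).Prime] (hr : W.analyticRank = 0) (hadd : Addv W 3) (hT : SubTprime W 3)
    (hirr : W.HasIrreducibleModPGaloisRep 3) (himg : HasSplitCartanNormalizerModPImage W 3)
    {c : absoluteGaloisGroup ℚ} (hc : IsComplexConjugation (Rat.castHom ℝ) c) (n : ℕ)
    (hrk : ∀ κE : ZpExtension ↥(fixedField (Subgroup.zpowers (absRestrictNormalHom (W.divisionField 3) c))) 3,
      κE.IsCyclotomic → classGroupPRank κE (n + 1) = classGroupPRank κE n) :
    MissingUpperBoundAt W 3 := by
  apply CartanMuRoadFukudaDoorsTprime.missingUpperBoundAt_three_tame_of_hasSplitCartanNormalizerModPImage_of_realRankSuccEqAt <;>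
    first
    | exact Literature.NumberTheory.IwasawaTheory.fukuda1994_thm1_classGroupPRank_const_of_succ_eq_holds
    | assumption

/-- **U₀ at a `3Nn` (t′) row from Fukuda Thm. 1 (2) (`3`-ranks) on `ℚ(P)`, `hram`-FREE, paying `hI`** (named facts
`hKatoA hGZK hmod hCS hI hFW hF2`; `rank₃ Cl(ℚ(P)_{n+1}) = rank₃ Cl(ℚ(P)_n)`) — the door for the RANK-STABLE KT rows. CONDITIONAL;
nothing booked; BSD for no curve. [cite: Kato2004Asterisque, Thm. 14.5 (3) (p. 236)] [cite: Fukuda1994, Thm. 1 (2), p. 264]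
[cite: CoatesSujatha2005, Thm. 3.4 (§3)] [cite: Serre1972, §2.4 Prop. 15, §5.2 (iv)]
UNCONDITIONAL IN FUKUDA: the hypothesis `hF2 : fukuda1994_thm1_classGroupPRank_const_of_succ_eq` of
`CartanMuRoadFukudaDoorsTprime.missingUpperBoundAt_three_tame_of_hasModPImageEqNonsplitCartanNormalizer_of_realRankSuccEqAt'` is discharged by `fukuda1994_thm1_classGroupPRank_const_of_succ_eq_holds`. -/
theorem missingUpperBoundAt_three_tame_of_hasModPImageEqNonsplitCartanNormalizer_of_realRankSuccEqAt'
    (W : WeierstrassCurve ℚ) [W.IsElliptic] [W.IsGloballyMinimal]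
    (hKatoA : Kato2004.rankZero_padicValNat_sha_add_padicValNat_tamagawa_le_of_additive_potGood_of_irreducible_of_fineSelmerDual_fg)
    (hGZK : rank_eq_analyticRank_of_analyticRank_le_one) (hmod : hasEntireLFunction_rat)
    (hCS : CoatesSujatha2005.thm34_fineSelmerDual_moduleFinite_of_classicalMuVanishes_divisionField)
    (hI : iwasawa1959_classNumberPExp_growth) (hFW : ferreroWashington1979_classicalMuVanishes)
    [Fact (3 : ℕ).Prime] (hr : W.analyticRank = 0) (hadd : Addv W 3) (hT : SubTprime W 3)
    (hirr : W.HasIrreducibleModPGaloisRep 3) (himg : HasModPImageEqNonsplitCartanNormalizer W 3)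
    {c : absoluteGaloisGroup ℚ} (hc : IsComplexConjugation (Rat.castHom ℝ) c) (n : ℕ)
    (hrk : ∀ κE : ZpExtension ↥(fixedField (Subgroup.zpowers (absRestrictNormalHom (W.divisionField 3) c))) 3,
      κE.IsCyclotomic → classGroupPRank κE (n + 1) = classGroupPRank κE n) :
    MissingUpperBoundAt W 3 := by
  apply CartanMuRoadFukudaDoorsTprime.missingUpperBoundAt_three_tame_of_hasModPImageEqNonsplitCartanNormalizer_of_realRankSuccEqAt' <;>
    first
    | exact Literature.NumberTheory.IwasawaTheory.fukuda1994_thm1_classGroupPRank_const_of_succ_eq_holds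
    | assumption

/-- **U₀ at a `3Ns` O6 row from Fukuda Thm. 1 (2) (`3`-ranks) on `ℚ(P)` at layers `(n, n+1)`, `hram`-FREE** (named facts
`hKatoA hGZK hmod hCS hFW hF2`; `rank₃ Cl(ℚ(P)_{n+1}) = rank₃ Cl(ℚ(P)_n)` (`hrk`)) — the door for the RANK-STABLE K9 rows 261360he1 / iv1.
CONDITIONAL; nothing booked; BSD for no curve. [cite: Kato2004Asterisque, Thm. 14.5 (3) (p. 236)] [cite: Fukuda1994, Thm. 1 (2), p. 264]
[cite: CoatesSujatha2005, Thm. 3.4 (§3)] [cite: Serre1972, §2.4 Prop. 15, §5.2 (iv)]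
UNCONDITIONAL IN FUKUDA: the hypothesis `hF2 : fukuda1994_thm1_classGroupPRank_const_of_succ_eq` of
`CartanMuRoadFukudaDoorsWild.missingUpperBoundAt_three_of_hasSplitCartanNormalizerModPImage_of_realRankSuccEqAt` is discharged by `fukuda1994_thm1_classGroupPRank_const_of_succ_eq_holds`. -/
theorem missingUpperBoundAt_three_of_hasSplitCartanNormalizerModPImage_of_realRankSuccEqAt
    (W : WeierstrassCurve ℚ) [W.IsElliptic] [W.IsGloballyMinimal]
    (hKatoA : Kato2004.rankZero_padicValNat_sha_add_padicValNat_tamagawa_le_of_additive_potGood_of_irreducible_of_fineSelmerDual_fg)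
    (hGZK : rank_eq_analyticRank_of_analyticRank_le_one) (hmod : hasEntireLFunction_rat)
    (hCS : CoatesSujatha2005.thm34_fineSelmerDual_moduleFinite_of_classicalMuVanishes_divisionField)
    (hFW : ferreroWashington1979_classicalMuVanishes)
    [Fact (3 : ℕ).Prime] (hr : W.analyticRank = 0) (hO : ClassO6 W 3) (hirr : W.HasIrreducibleModPGaloisRep 3)
    (himg : HasSplitCartanNormalizerModPImage W 3) {c : absoluteGaloisGroup ℚ} (hc : IsComplexConjugation (Rat.castHom ℝ) c)
    (n : ℕ)
    (hrk : ∀ κE : ZpExtension ↥(fixedField (Subgroup.zpowers (absRestrictNormalHom (W.divisionField 3) c))) 3,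
      κE.IsCyclotomic → classGroupPRank κE (n + 1) = classGroupPRank κE n) :
    MissingUpperBoundAt W 3 := by
  apply CartanMuRoadFukudaDoorsWild.missingUpperBoundAt_three_of_hasSplitCartanNormalizerModPImage_of_realRankSuccEqAt <;>
    first
    | exact Literature.NumberTheory.IwasawaTheory.fukuda1994_thm1_classGroupPRank_const_of_succ_eq_holds
    | assumption

/-- **U₀ at a `3Nn` O6 row from Fukuda Thm. 1 (2) (`3`-ranks) on `ℚ(P)` at layers `(n, n+1)`, `hram`-FREE, paying `hI`** (named facts
`hKatoA hGZK hmod hCS hI hFW hF2`; `rank₃ Cl(ℚ(P)_{n+1}) = rank₃ Cl(ℚ(P)_n)`). CONDITIONAL; nothing booked; BSD for no curve.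
[cite: Kato2004Asterisque, Thm. 14.5 (3) (p. 236)] [cite: Fukuda1994, Thm. 1 (2), p. 264] [cite: CoatesSujatha2005, Thm. 3.4 (§3)]
[cite: Serre1972, §2.4 Prop. 15, §5.2 (iv)]
UNCONDITIONAL IN FUKUDA: the hypothesis `hF2 : fukuda1994_thm1_classGroupPRank_const_of_succ_eq` of
`CartanMuRoadFukudaDoorsWild.missingUpperBoundAt_three_of_hasModPImageEqNonsplitCartanNormalizer_of_realRankSuccEqAt'` is discharged by `fukuda1994_thm1_classGroupPRank_const_of_succ_eq_holds`. -/
theorem missingUpperBoundAt_three_of_hasModPImageEqNonsplitCartanNormalizer_of_realRankSuccEqAt'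
    (W : WeierstrassCurve ℚ) [W.IsElliptic] [W.IsGloballyMinimal]
    (hKatoA : Kato2004.rankZero_padicValNat_sha_add_padicValNat_tamagawa_le_of_additive_potGood_of_irreducible_of_fineSelmerDual_fg)
    (hGZK : rank_eq_analyticRank_of_analyticRank_le_one) (hmod : hasEntireLFunction_rat)
    (hCS : CoatesSujatha2005.thm34_fineSelmerDual_moduleFinite_of_classicalMuVanishes_divisionField)
    (hI : iwasawa1959_classNumberPExp_growth) (hFW : ferreroWashington1979_classicalMuVanishes)
    [Fact (3 : ℕ).Prime] (hr : W.analyticRank = 0) (hO : ClassO6 W 3) (hirr : W.HasIrreducibleModPGaloisRep 3)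
    (himg : HasModPImageEqNonsplitCartanNormalizer W 3) {c : absoluteGaloisGroup ℚ}
    (hc : IsComplexConjugation (Rat.castHom ℝ) c) (n : ℕ)
    (hrk : ∀ κE : ZpExtension ↥(fixedField (Subgroup.zpowers (absRestrictNormalHom (W.divisionField 3) c))) 3,
      κE.IsCyclotomic → classGroupPRank κE (n + 1) = classGroupPRank κE n) :
    MissingUpperBoundAt W 3 := by
  apply CartanMuRoadFukudaDoorsWild.missingUpperBoundAt_three_of_hasModPImageEqNonsplitCartanNormalizer_of_realRankSuccEqAt' <;>
    first
    | exact Literature.NumberTheory.IwasawaTheory.fukuda1994_thm1_classGroupPRank_const_of_succ_eq_holds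
    | assumption

end Summit.BirchSwinnertonDyer.BirchSwinnertonDyer.Theorems.CartanMuRoadFukudaDoorsF2

end
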